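import Summits.HodgeConjecture.HodgeConjecture.Theses.PeriodsPolice

/-!
# Birth skeleton of piece P3 `BettiHodgeRiemannI` : `∀ B : BettiHodgeData ℂ, B.IsClassicalHodge → HodgeRiemannIStatement B`

Two stubs and the kernel-checked composition `BettiHodgeRiemannI_of`:
* `stub_lefschetzForm_eq_trace_of_fil` — the TYPE COMPUTATION: for a pinned datum, `x ∈ Fᵖ Hⁱ`,
  `y ∈ F^{i+1-p} Hⁱ`, `η` a hyperplane class (a Hodge class, in `F¹ H²`), `i + r = n`: the complexified
  Lefschetz form `Q(x, y)` is the complexified trace of a class `z = x ∪ y ∪ ηʳ ∈ F^{n+1} H^{2n}`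
  (multiplicativity of the Hodge filtration under cup product on `X^an`, Voisin I Lemma 7.30, read on
  `B` through the pin (i') and `B.iso_cup`);
* `stub_hodgeFiltration_top` — `F^{n+1} H^{2n}(X) = 0` for a pinned datum (`H^{2n}(X^an) = H^{n,n}`,
  Voisin I Thm. 6.32 proof / Cor. to the Hodge decomposition);
composition: `Q(x, y) = tr_ℂ(z)`, `z ∈ F^{n+1} H^{2n} = ⊥`, so `Q(x, y) = 0` (Voisin I Thm. 6.32 (i)).
-/

set_option linter.dupNamespace false

namespace Summit.HodgeConjecture.HodgeConjecture.Cruxes.ClassicalBridge.PiecesSplit.P3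

open scoped TensorProduct
open Literature.AlgebraicGeometry.Motives Literature.AlgebraicGeometry.HodgeTheory

/-- Stub 1 (type computation): `Q(x, y) = tr_ℂ(z)` with `z ∈ F^{n+1} H^{2n}`.
[VoisinHodgeI2002 Lemma 7.30 and Thm. 6.32 (i)] -/
theorem stub_lefschetzForm_eq_trace_of_fil :
    ∀ (B : BettiHodgeData ℂ), B.IsClassicalHodge →
      ∀ ⦃n : ℕ⦄ ⦃X : SchemeOver ℂ⦄ (hX : IsSmoothProjective n X) ⦃η : B.W.obj X 2⦄,
        B.W.IsHyperplaneClass X η → ∀ ⦃i r j : ℕ⦄ (hr : i + r = n) (hj : i + 2 * r = j) (p : ℤ)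
          ⦃x y : ℂ ⊗[ℚ] B.W.obj X i⦄, x ∈ (B.hodge hX i).F p → y ∈ (B.hodge hX i).F (i + 1 - p) →
            ∃ z ∈ (B.hodge hX (2 * n)).F ((n : ℤ) + 1),
              (B.W.lefschetzForm X (n := n) η i r j hj (by omega)).baseChange ℂ x y =
                Module.Dual.baseChange ℂ (B.W.trace X n) z := by
  sorry

/-- Stub 2 (top vanishing): `F^{n+1} H^{2n}(X) = 0` for a pinned Betti–Hodge datum.
[VoisinHodgeI2002 §6.1.3 and §7.1.1] -/
theorem stub_hodgeFiltration_top :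
    ∀ (B : BettiHodgeData ℂ), B.IsClassicalHodge →
      ∀ ⦃n : ℕ⦄ ⦃X : SchemeOver ℂ⦄ (hX : IsSmoothProjective n X),
        (B.hodge hX (2 * n)).F ((n : ℤ) + 1) = ⊥ := by
  sorry

/-- Composition: the two stubs give P3. -/
theorem BettiHodgeRiemannI_of
    (h₁ : ∀ (B : BettiHodgeData ℂ), B.IsClassicalHodge →
      ∀ ⦃n : ℕ⦄ ⦃X : SchemeOver ℂ⦄ (hX : IsSmoothProjective n X) ⦃η : B.W.obj X 2⦄,
        B.W.IsHyperplaneClass X η → ∀ ⦃i r j : ℕ⦄ (hr : i + r = n) (hj : i + 2 * r = j) (p : ℤ)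
          ⦃x y : ℂ ⊗[ℚ] B.W.obj X i⦄, x ∈ (B.hodge hX i).F p → y ∈ (B.hodge hX i).F (i + 1 - p) →
            ∃ z ∈ (B.hodge hX (2 * n)).F ((n : ℤ) + 1),
              (B.W.lefschetzForm X (n := n) η i r j hj (by omega)).baseChange ℂ x y =
                Module.Dual.baseChange ℂ (B.W.trace X n) z)
    (h₂ : ∀ (B : BettiHodgeData ℂ), B.IsClassicalHodge →
      ∀ ⦃n : ℕ⦄ ⦃X : SchemeOver ℂ⦄ (hX : IsSmoothProjective n X),
        (B.hodge hX (2 * n)).F ((n : ℤ) + 1) = ⊥) :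
    ∀ B : BettiHodgeData ℂ, B.IsClassicalHodge → HodgeRiemannIStatement B := by
  intro B hB n X hX η hη i r j hr hj p x y hx hy
  obtain ⟨z, hz, hQ⟩ := h₁ B hB hX hη hr hj p hx hy
  rw [h₂ B hB hX, Submodule.mem_bot] at hz
  rw [hQ, hz, map_zero]

/-- P3 from the stubs. -/
theorem bettiHodgeRiemannI : ∀ B : BettiHodgeData ℂ, B.IsClassicalHodge → HodgeRiemannIStatement B :=
  BettiHodgeRiemannI_of stub_lefschetzForm_eq_trace_of_fil stub_hodgeFiltration_top

end Summit.HodgeConjecture.HodgeConjecture.Cruxes.ClassicalBridge.PiecesSplit.P3
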